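import Mathlib
import HarnessLib
import Summits.NavierStokesRegularity.NavierStokesRegularity.Theses.AxisTwistDoor
import Summits.NavierStokesRegularity.NavierStokesRegularity.Theses.FilamentPinchDoor
import Summits.NavierStokesRegularity.NavierStokesRegularity.Theorems.AxisTwistDoorTiltDominationLocDefs
import Summits.NavierStokesRegularity.NavierStokesRegularity.Theorems.AxisTwistDoorTiltDominationLocNeckLength
import Summits.NavierStokesRegularity.NavierStokesRegularity.Theorems.AxisTwistDoorAveragedConeLiouvilleHolds
import Summits.NavierStokesRegularity.NavierStokesRegularity.Theorems.AxisTwistDoorScalingToUnit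
import Summits.NavierStokesRegularity.NavierStokesRegularity.Theorems.AxisTwistDoorRotationToAxis
import Summits.NavierStokesRegularity.NavierStokesRegularity.Theorems.HalfSpaceWindowDoorCirculationCarryingRigidityDefs
import Summits.NavierStokesRegularity.NavierStokesRegularity.Theorems.IsobarTomographyTubeAlternativeStubDefectAnalyticOfVelocity
import Summits.NavierStokesRegularity.NavierStokesRegularity.Theorems.LocalSineTubeDoorProfileAlignedWindowRigidity

/-!
# AxisTwistDoor · crux `TiltDominationLoc` (stmt-NavierStokesRegularity-26991) — THE RIGIDITY DICTIONARY
# (what the research crux and its two open stubs ARE, kernel-checked)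

The only open item of route `AxisTwistDoor` after 2026-08-28T14:00Z is the research crux `TiltDominationLoc` (rank 2,
XL).  Since the rest of the route is PROVED (`averagedConeLiouville_holds`, `scalingToUnit_proof`,
`rotationToAxis_proof`, …), the crux is EQUIVALENT to the one-signed Type-I Liouville statement of the energy class;
this file proves that and factorises it through the birth skeleton's two open stubs, themselves identified:

* `tiltDominationLoc_iff_oneSignedRigidity : TiltDominationLoc ↔ OneSignedRigidity` — the crux IS «no profile of the
  energy class with `ω₃ ≥ 0` and linear `e₃`-growth is backward-singular at the apex» (Lei–Ren–Tian arXiv:2501.08976,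
  Remark 1.3, restricted to the Type-I energy class); `←` is vacuous, `→` is `ScalingToUnit ∘ AveragedConeLiouville`.
* `stubNoPlanarCollar_iff_poloidalRigidity : StubNoPlanarCollar ↔ PoloidalRigidity` — stub 0 IS the energy-class
  poloidal (`ω₃ ≡ 0`) Type-I Liouville statement; `poloidalRigidity_of_poloidalWindowRigidity` types the edge from the
  shared crux `FilamentPinchDoor.PoloidalWindowRigidity` (item 19708).
* `stubApexTiltOfNeckLoc_iff_singularIsPoloidal : StubApexTiltOfNeckLoc ↔ SingularIsPoloidal` — stub 2 IS «a
  backward-singular one-signed profile of the class has `ω₃ ≡ 0`».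
* `oneSignedRigidity_iff : OneSignedRigidity ↔ PoloidalRigidity ∧ SingularIsPoloidal` and
  `tiltDominationLoc_iff_stubs : TiltDominationLoc ↔ StubNoPlanarCollar ∧ StubApexTiltOfNeckLoc` — the skeleton of
  record loses nothing: the crux holds iff both open stubs hold.
* `stub_neckLength : StubNeckLength` — stub 1 by name (ns-el-k1b's `…TiltDominationLoc.NeckLength.neckLength`, p628658).
* §3, THE LEAF'S THREE ROUTES MEET: `singularIsPoloidal_of_filamentPinchLiouville` (FilamentPinchDoor's research crux
  26430 at `e = e₃` IS stub 2's content), `singularIsPoloidal_of_circulationCarryingRigidity` /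
  `singularIsPoloidal_of_hemisphereLiouvilleE3` (HalfSpaceWindowDoor's research crux 25311 and its re-typed research
  stub `HemisphereLiouvilleE3` each imply it), `tiltDominationLoc_of_filamentPinchDoor : PoloidalWindowRigidity →
  FilamentPinchLiouville → TiltDominationLoc` (26991 ⟸ 19708 ∧ 26430) and `filamentPinchLiouville_of_tiltDominationLoc :
  TiltDominationLoc → FilamentPinchLiouville` (26991 ⟹ 26430, via `rotationToAxis_proof`).  So the research content
  of route `AxisTwistDoor` is NOT a new open problem: it is sandwiched between FilamentPinchDoor's crux pair and its
  crux 26430.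

The analytic input is `omega3_eq_zero_of_collar`: for a profile of the class with `ω₃ ≥ 0`, if every axis circle of a
parabolic neighbourhood of the apex carries non-positive `ω₃`-flux then `ω₃ ≡ 0` on the WHOLE backward slab — the
vorticity of a class profile is jointly real-analytic on the connected open slab
(`TubeAlternative.AnalyticPropagation.analyticOnNhd_uncurry_curl` ∘ `…Ancient.analyticOnNhd_uncurry`), and a
non-negative continuous integrand with non-positive integral vanishes.

WHAT THIS IS NOT: none of `TiltDominationLoc`, `OneSignedRigidity`, `PoloidalRigidity`, `SingularIsPoloidal` is proved
here (all OPEN); no Navier–Stokes regularity statement is proved (Clay A OPEN); the leaf `HalfSpaceWindowDoor.Target`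
is OPEN.  Seat ns-atd-p1 (LEAD g3).  [cite: arXiv:2501.08976, Thm 1.1 and Rem. 1.3; KochNadirashviliSereginSverak2009, §5]
-/

noncomputable section

-- the summit and its single sub-problem share the name (CONVENTIONS §1), as in every Theorems file
set_option linter.dupNamespace false


namespace Summit.NavierStokesRegularity.NavierStokesRegularity.Theorems.AxisTwistDoorTiltDominationLocRigidity

open scoped InnerProductSpace RealInnerProductSpace
open Set Function Filter Topology MeasureTheory Metric
open Literature.Analysis Literature.Analysis.FluidPDE
open Summit.NavierStokesRegularity.NavierStokesRegularity.Theses.AxisTwistDoor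
open Summit.NavierStokesRegularity.NavierStokesRegularity.Theorems.AxisTwistDoorTiltDominationLocDefs
open Summit.NavierStokesRegularity.NavierStokesRegularity.Theorems.LocalSineTubeDoorProfileAlignedWindowRigidityAncient
  (analyticOnNhd_uncurry bdd_of_hasTypeITimeDecay continuous_slice)
open Summit.NavierStokesRegularity.NavierStokesRegularity.Theorems.TubeAlternative.AnalyticPropagation
  (analyticOnNhd_uncurry_curl)
open Summit.NavierStokesRegularity.NavierStokesRegularity.Theorems.LocalSineTubeDoorProfileAlignedWindowRigidity
  (continuous_curl_slice)

variable {C : ℝ} {v : ℝ → EuclideanSpace ℝ (Fin 3) → EuclideanSpace ℝ (Fin 3)}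


/-- The vertical vorticity `(s,y) ↦ ⟪curl v(s) y, e₃⟫` of a profile of the class (rate, continuity, Oseen identity)
is JOINTLY real-analytic on the open backward slab `(−∞,0) × ℝ³`. -/
theorem analyticOnNhd_omega3 (hrate : HasTypeITimeDecay C v)
    (hcont : ContinuousOn (uncurry v) (Iio (0 : ℝ) ×ˢ univ))
    (hmild : ∀ s t : ℝ, s < t → t < 0 → ∀ x,
      v t x = UnboundedOperators.heatExtension (v s) (t - s) x - oseenDuhamel 1 s v v t x) :
    AnalyticOnNhd ℝ (fun p : ℝ × EuclideanSpace ℝ (Fin 3) =>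
      ⟪curl (v p.1) p.2, (EuclideanSpace.single (2 : Fin 3) (1 : ℝ))⟫_ℝ) (Iio (0 : ℝ) ×ˢ univ) := by
  have hF : AnalyticOnNhd ℝ (uncurry fun t x => curl (v t) x) (Iio (0 : ℝ) ×ˢ univ) :=
    analyticOnNhd_uncurry_curl (analyticOnNhd_uncurry hcont (bdd_of_hasTypeITimeDecay hrate) hmild) isOpen_Iio
  have h1 := (innerSL ℝ (EuclideanSpace.single (2 : Fin 3) (1 : ℝ))).comp_analyticOnNhd hF
  have h2 : (fun p : ℝ × EuclideanSpace ℝ (Fin 3) =>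
      ⟪curl (v p.1) p.2, (EuclideanSpace.single (2 : Fin 3) (1 : ℝ))⟫_ℝ) =
      (innerSL ℝ (EuclideanSpace.single (2 : Fin 3) (1 : ℝ))) ∘ (uncurry fun t x => curl (v t) x) := by
    funext p
    simp only [Function.comp_apply, innerSL_apply_apply]
    exact real_inner_comm _ _
  rw [h2]
  exact h1

/-- Every point off the vertical axis is a cylindrical point `(r cos θ, r sin θ, z)` with `r = ‖y_h‖ > 0`,
`θ ∈ [0, 2π]`, `z = y₃`. -/
theorem exists_cyl_repr (y : EuclideanSpace ℝ (Fin 3)) (hy : y 0 ≠ 0 ∨ y 1 ≠ 0) :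
    ∃ r θ : ℝ, 0 < r ∧ r ^ 2 = y 0 ^ 2 + y 1 ^ 2 ∧ 0 ≤ θ ∧ θ ≤ 2 * Real.pi ∧
      (WithLp.toLp 2 ![r * Real.cos θ, r * Real.sin θ, y 2] : EuclideanSpace ℝ (Fin 3)) = y := by
  set w : ℂ := ⟨y 0, y 1⟩ with hw
  have hw0 : w ≠ 0 := by
    intro h
    rcases hy with h0 | h1
    · exact h0 (by simpa [hw] using congrArg Complex.re h)
    · exact h1 (by simpa [hw] using congrArg Complex.im h)
  have hr : 0 < ‖w‖ := norm_pos_iff.2 hw0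
  have hcos : ‖w‖ * Real.cos (Complex.arg w) = y 0 := by rw [Complex.norm_mul_cos_arg]
  have hsin : ‖w‖ * Real.sin (Complex.arg w) = y 1 := by rw [Complex.norm_mul_sin_arg]
  have hsq : ‖w‖ ^ 2 = y 0 ^ 2 + y 1 ^ 2 := by
    rw [← Complex.normSq_eq_norm_sq, Complex.normSq_apply]; ring
  -- shift the argument into `[0, 2π]`
  obtain ⟨θ, hθ0, hθ1, hcθ, hsθ⟩ : ∃ θ : ℝ, 0 ≤ θ ∧ θ ≤ 2 * Real.pi ∧
      Real.cos θ = Real.cos (Complex.arg w) ∧ Real.sin θ = Real.sin (Complex.arg w) := by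
    by_cases h : 0 ≤ Complex.arg w
    · exact ⟨Complex.arg w, h, (Complex.arg_le_pi w).trans (by linarith [Real.pi_pos]), rfl, rfl⟩
    · refine ⟨Complex.arg w + 2 * Real.pi, by linarith [Complex.neg_pi_lt_arg w], by linarith [not_le.1 h],
        Real.cos_add_two_pi _, Real.sin_add_two_pi _⟩
  refine ⟨‖w‖, θ, hr, hsq, hθ0, hθ1, ?_⟩
  ext i
  fin_cases i
  · simp [hcθ, hcos]
  · simp [hsθ, hsin]
  · simp

/-- **A planar collar forces a poloidal profile.**  If `ω₃ = ⟪curl v, e₃⟫ ≥ 0` everywhere and every axis circle of a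
parabolic neighbourhood `{−δ² < s < 0, 0 < r < δ, |z| < δ}` of the apex carries non-positive `ω₃`-flux
`∫₀^{2π} ω₃(r cos θ, r sin θ, z) r dθ ≤ 0`, then `ω₃ ≡ 0` on the WHOLE backward slab: `ω₃` vanishes on an open
subset of the slab (non-negative continuous integrand with non-positive integral), and the vorticity of a profile of
the class is jointly real-analytic on the connected slab (identity theorem). -/
theorem omega3_eq_zero_of_collar (hrate : HasTypeITimeDecay C v)
    (hcont : ContinuousOn (uncurry v) (Iio (0 : ℝ) ×ˢ univ))
    (hmild : ∀ s t : ℝ, s < t → t < 0 → ∀ x,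
      v t x = UnboundedOperators.heatExtension (v s) (t - s) x - oseenDuhamel 1 s v v t x)
    (hnn : ∀ s < 0, ∀ y, 0 ≤ ⟪curl (v s) y, (EuclideanSpace.single (2 : Fin 3) (1 : ℝ))⟫_ℝ)
    {δ : ℝ} (hδ : 0 < δ)
    (hcollar : ∀ s : ℝ, -δ ^ 2 < s → s < 0 → ∀ r : ℝ, 0 < r → r < δ → ∀ z : ℝ, |z| < δ →
      ∫ θ in (0 : ℝ)..(2 * Real.pi), ⟪curl (v s)
        (WithLp.toLp 2 ![r * Real.cos θ, r * Real.sin θ, z] : EuclideanSpace ℝ (Fin 3)),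
        (EuclideanSpace.single (2 : Fin 3) (1 : ℝ))⟫_ℝ * r ≤ 0) :
    ∀ s < 0, ∀ y, ⟪curl (v s) y, (EuclideanSpace.single (2 : Fin 3) (1 : ℝ))⟫_ℝ = 0 := by
  -- Step 1: `ω₃ = 0` at every point of the punctured collar
  have hzero : ∀ s : ℝ, -δ ^ 2 < s → s < 0 → ∀ y : EuclideanSpace ℝ (Fin 3), (y 0 ≠ 0 ∨ y 1 ≠ 0) →
      y 0 ^ 2 + y 1 ^ 2 < δ ^ 2 → |y 2| < δ →
      ⟪curl (v s) y, (EuclideanSpace.single (2 : Fin 3) (1 : ℝ))⟫_ℝ = 0 := by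
    intro s hs1 hs2 y hy hyr hyz
    obtain ⟨r, θ₀, hr, hrsq, hθ0, hθ1, hrepr⟩ := exists_cyl_repr y hy
    have hrδ : r < δ := by
      by_contra h
      have : δ ^ 2 ≤ r ^ 2 := by nlinarith [not_lt.1 h, hδ.le]
      linarith
    set f : ℝ → ℝ := fun θ => ⟪curl (v s)
        (WithLp.toLp 2 ![r * Real.cos θ, r * Real.sin θ, y 2] : EuclideanSpace ℝ (Fin 3)),
        (EuclideanSpace.single (2 : Fin 3) (1 : ℝ))⟫_ℝ * r with hf
    have hfc : Continuous f := by
      have hc : Continuous (curl (v s)) := continuous_curl_slice hrate hcont hmild hs2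
      have hp : Continuous fun θ : ℝ =>
          (WithLp.toLp 2 ![r * Real.cos θ, r * Real.sin θ, y 2] : EuclideanSpace ℝ (Fin 3)) := by
        refine (PiLp.continuous_toLp 2 _).comp ?_
        refine continuous_pi fun i => ?_
        fin_cases i
        · exact continuous_const.mul Real.continuous_cos
        · exact continuous_const.mul Real.continuous_sin
        · exact continuous_const
      exact ((hc.comp hp).inner continuous_const).mul continuous_const
    have hfnn : ∀ θ, 0 ≤ f θ := fun θ => mul_nonneg (hnn s hs2 _) hr.le
    have hint : ∫ θ in (0 : ℝ)..(2 * Real.pi), f θ ≤ 0 := hcollar s hs1 hs2 r hr hrδ (y 2) hyz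
    -- the non-negative continuous integrand with non-positive integral vanishes on `[0, 2π]`
    have hfθ : f θ₀ = 0 := by
      by_contra hne
      have hpos : 0 < f θ₀ := lt_of_le_of_ne (hfnn θ₀) (Ne.symm hne)
      have hlt : (∫ θ in (0 : ℝ)..(2 * Real.pi), (fun _ => (0 : ℝ)) θ) < ∫ θ in (0 : ℝ)..(2 * Real.pi), f θ :=
        intervalIntegral.integral_lt_integral_of_continuousOn_of_le_of_exists_lt (by positivity)
          continuousOn_const hfc.continuousOn (fun x _ => hfnn x) ⟨θ₀, ⟨hθ0, hθ1⟩, hpos⟩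
      simp only [intervalIntegral.integral_const, smul_zero] at hlt
      linarith
    have h1 : ⟪curl (v s) y, (EuclideanSpace.single (2 : Fin 3) (1 : ℝ))⟫_ℝ * r = 0 := by
      rw [← hrepr]; exact hfθ
    rcases mul_eq_zero.1 h1 with h | h
    · exact h
    · exact absurd h hr.ne'
  -- Step 2: identity theorem on the connected slab
  have han := analyticOnNhd_omega3 hrate hcont hmild
  set y₀ : EuclideanSpace ℝ (Fin 3) := WithLp.toLp 2 ![δ / 2, 0, 0] with hy₀
  have hy₀0 : y₀ 0 = δ / 2 := by simp [hy₀]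
  have hy₀1 : y₀ 1 = 0 := by simp [hy₀]
  have hy₀2 : y₀ 2 = 0 := by simp [hy₀]
  set p₀ : ℝ × EuclideanSpace ℝ (Fin 3) := (-δ ^ 2 / 2, y₀) with hp₀
  have hp₀mem : p₀ ∈ Iio (0 : ℝ) ×ˢ (univ : Set (EuclideanSpace ℝ (Fin 3))) :=
    ⟨by show -δ ^ 2 / 2 < 0; nlinarith [hδ], mem_univ _⟩
  have hW : Ioo (-δ ^ 2) 0 ×ˢ ball y₀ (δ / 4) ∈ 𝓝 p₀ :=
    prod_mem_nhds (Ioo_mem_nhds (by nlinarith [hδ]) (by nlinarith [hδ])) (ball_mem_nhds _ (by positivity))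
  have hev : (fun p : ℝ × EuclideanSpace ℝ (Fin 3) =>
      ⟪curl (v p.1) p.2, (EuclideanSpace.single (2 : Fin 3) (1 : ℝ))⟫_ℝ) =ᶠ[𝓝 p₀] 0 := by
    filter_upwards [hW] with p hp
    obtain ⟨⟨hs1, hs2⟩, hball⟩ := hp
    rw [mem_ball, dist_eq_norm] at hball
    have hc0 : |p.2 0 - δ / 2| < δ / 4 := by
      have h := PiLp.norm_apply_le (p.2 - y₀) 0
      rw [PiLp.sub_apply, hy₀0, Real.norm_eq_abs] at h
      exact lt_of_le_of_lt h hball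
    have hc1 : |p.2 1| < δ / 4 := by
      have h := PiLp.norm_apply_le (p.2 - y₀) 1
      rw [PiLp.sub_apply, hy₀1, sub_zero, Real.norm_eq_abs] at h
      exact lt_of_le_of_lt h hball
    have hc2 : |p.2 2| < δ / 4 := by
      have h := PiLp.norm_apply_le (p.2 - y₀) 2
      rw [PiLp.sub_apply, hy₀2, sub_zero, Real.norm_eq_abs] at h
      exact lt_of_le_of_lt h hball
    have h0pos : 0 < p.2 0 := by
      have := (abs_lt.1 hc0).1
      linarith
    refine hzero p.1 hs1 hs2 p.2 (Or.inl h0pos.ne') ?_ (by linarith [abs_nonneg (p.2 2)])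
    have ha : p.2 0 < 3 * δ / 4 := by have := (abs_lt.1 hc0).2; linarith
    have hb := abs_lt.1 hc1
    nlinarith
  have hpre : IsPreconnected (Iio (0 : ℝ) ×ˢ (univ : Set (EuclideanSpace ℝ (Fin 3)))) :=
    ((convex_Iio 0).prod convex_univ).isPreconnected
  intro s hs y
  have := han.eqOn_zero_of_preconnected_of_eventuallyEq_zero hpre hp₀mem hev
    (show (s, y) ∈ Iio (0 : ℝ) ×ˢ (univ : Set (EuclideanSpace ℝ (Fin 3))) from ⟨hs, mem_univ _⟩)
  simpa using this

/-- Contrapositive packaging: a one-signed profile of the class which is NOT poloidal has a non-planar apex. -/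
theorem nonPlanarApex_of_not_poloidal (hrate : HasTypeITimeDecay C v)
    (hcont : ContinuousOn (uncurry v) (Iio (0 : ℝ) ×ˢ univ))
    (hmild : ∀ s t : ℝ, s < t → t < 0 → ∀ x,
      v t x = UnboundedOperators.heatExtension (v s) (t - s) x - oseenDuhamel 1 s v v t x)
    (hnn : ∀ s < 0, ∀ y, 0 ≤ ⟪curl (v s) y, (EuclideanSpace.single (2 : Fin 3) (1 : ℝ))⟫_ℝ)
    (hnp : ¬ ∀ s < 0, ∀ y, ⟪curl (v s) y, (EuclideanSpace.single (2 : Fin 3) (1 : ℝ))⟫_ℝ = 0) :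
    NonPlanarApex v := by
  intro δ hδ
  by_contra h
  push Not at h
  exact hnp (omega3_eq_zero_of_collar hrate hcont hmild hnn hδ
    fun s hs1 hs2 r hr hrδ z hz => h s r z hs1 hs2 hr hrδ hz)

/-- A poloidal profile has no non-planar apex (every `ω₃`-flux vanishes). -/
theorem not_nonPlanarApex_of_poloidal
    (hpol : ∀ s < 0, ∀ y, ⟪curl (v s) y, (EuclideanSpace.single (2 : Fin 3) (1 : ℝ))⟫_ℝ = 0) :
    ¬ NonPlanarApex v := by
  intro h
  obtain ⟨s, r, z, -, hs, -, -, -, hpos⟩ := h 1 one_pos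
  have : ∫ θ in (0 : ℝ)..(2 * Real.pi), ⟪curl (v s)
      (WithLp.toLp 2 ![r * Real.cos θ, r * Real.sin θ, z] : EuclideanSpace ℝ (Fin 3)),
      (EuclideanSpace.single (2 : Fin 3) (1 : ℝ))⟫_ℝ * r = 0 := by
    simp [hpol s hs]
  linarith


/-- **The crux is the one-signed Type-I Liouville statement of the energy class**:
`TiltDominationLoc ↔ OneSignedRigidity`.  (`←`) is vacuous (the crux only speaks about backward-singular profiles);
(`→`) is the proved chain of the route: the localised averaged cone feeds `ScalingToUnit` ∘ `AveragedConeLiouville`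
(`scalingToUnit_proof`, `averagedConeLiouville_holds`), which forbids the singular apex. -/
theorem tiltDominationLoc_iff_oneSignedRigidity : TiltDominationLoc ↔ OneSignedRigidity := by
  constructor
  · intro hT C v π H hdecay hcont hmild hdiv hsw hwg hI hnn hK hsing
    exact AxisTwistDoorScalingToUnit.scalingToUnit_proof
      AxisTwistDoorAveragedConeLiouvilleHolds.averagedConeLiouville_holds C v π H hdecay hcont hmild hdiv hsw hwg hI
      hnn (hT C v π H hdecay hcont hmild hdiv hsw hwg hI hnn hK hsing) hsing
  · intro hR C v π H hdecay hcont hmild hdiv hsw hwg hI hnn hK hsing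
    exact absurd hsing (hR C v π H hdecay hcont hmild hdiv hsw hwg hI hnn hK)

/-- **Stub 0 is the energy-class poloidal rigidity**: `StubNoPlanarCollar ↔ PoloidalRigidity`.  (`→`) a poloidal
class profile is one-signed with linear growth (`K = 0`), so a singular apex would give it a non-planar apex, which a
poloidal profile does not have; (`←`) a one-signed singular class profile with a planar collar is poloidal by analytic
continuation (`omega3_eq_zero_of_collar`), contradicting `PoloidalRigidity`. -/
theorem stubNoPlanarCollar_iff_poloidalRigidity : StubNoPlanarCollar ↔ PoloidalRigidity := by
  constructor
  · intro h0 C v π H hdecay hcont hmild hdiv hsw hwg hI hpol hsing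
    have hnn : ∀ s < 0, ∀ y, 0 ≤ ⟪curl (v s) y, (EuclideanSpace.single (2 : Fin 3) (1 : ℝ))⟫_ℝ :=
      fun s hs y => (hpol s hs y).symm.le
    have hK : ∃ K : ℝ, ∀ s < 0, ∀ (x : EuclideanSpace ℝ (Fin 3)) (R : ℝ), 0 < R →
        ∫⁻ y in Metric.ball x R, ENNReal.ofReal ⟪curl (v s) y, (EuclideanSpace.single (2 : Fin 3) (1 : ℝ))⟫_ℝ
          ≤ ENNReal.ofReal (K * R) :=
      ⟨0, fun s hs x R _ => by simp [hpol s hs]⟩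
    exact not_nonPlanarApex_of_poloidal hpol (h0 C v π H hdecay hcont hmild hdiv hsw hwg hI hnn hK hsing)
  · intro hP C v π H hdecay hcont hmild hdiv hsw hwg hI hnn hK hsing
    refine nonPlanarApex_of_not_poloidal hdecay hcont hmild hnn fun hpol => ?_
    exact hP C v π H hdecay hcont hmild hdiv hsw hwg hI hpol hsing

/-- **Stub 2 says that a singular one-signed profile is poloidal**: `StubApexTiltOfNeckLoc ↔ SingularIsPoloidal`.
(`→`) a singular one-signed class profile which is not poloidal has a non-planar apex (analytic continuation) and the
neck bound (`neckLength`, stub 1 PROVED), so stub 2 cones it locally and `ScalingToUnit` ∘ `AveragedConeLiouville`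
makes the apex regular — absurd; (`←`) a singular one-signed class profile is poloidal, so the hypothesis
`NonPlanarApex` of stub 2 is never met. -/
theorem stubApexTiltOfNeckLoc_iff_singularIsPoloidal : StubApexTiltOfNeckLoc ↔ SingularIsPoloidal := by
  constructor
  · intro h2 C v π H hdecay hcont hmild hdiv hsw hwg hI hnn hK hsing
    by_contra hnp
    have hneck : NeckBound v :=
      TiltDominationLoc.NeckLength.neckLength C v π H hdecay hcont hmild hdiv hsw hwg hI
    have hcone := h2 C v π H hdecay hcont hmild hdiv hsw hwg hI hnn hK hsing hneck
      (nonPlanarApex_of_not_poloidal hdecay hcont hmild hnn hnp)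
    exact AxisTwistDoorScalingToUnit.scalingToUnit_proof
      AxisTwistDoorAveragedConeLiouvilleHolds.averagedConeLiouville_holds C v π H hdecay hcont hmild hdiv hsw hwg hI
      hnn hcone hsing
  · intro hS C v π H hdecay hcont hmild hdiv hsw hwg hI hnn hK hsing _ hnp
    exact absurd hnp (not_nonPlanarApex_of_poloidal (hS C v π H hdecay hcont hmild hdiv hsw hwg hI hnn hK hsing))

/-- **Factorisation of the crux**: `OneSignedRigidity ↔ PoloidalRigidity ∧ SingularIsPoloidal`. -/
theorem oneSignedRigidity_iff : OneSignedRigidity ↔ PoloidalRigidity ∧ SingularIsPoloidal := by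
  constructor
  · intro hR
    refine ⟨fun C v π H hdecay hcont hmild hdiv hsw hwg hI hpol => ?_,
      fun C v π H hdecay hcont hmild hdiv hsw hwg hI hnn hK hsing => ?_⟩
    · refine hR C v π H hdecay hcont hmild hdiv hsw hwg hI (fun s hs y => (hpol s hs y).symm.le) ?_
      exact ⟨0, fun s hs x R _ => by simp [hpol s hs]⟩
    · exact absurd hsing (hR C v π H hdecay hcont hmild hdiv hsw hwg hI hnn hK)
  · rintro ⟨hP, hS⟩ C v π H hdecay hcont hmild hdiv hsw hwg hI hnn hK hsing
    exact hP C v π H hdecay hcont hmild hdiv hsw hwg hI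
      (hS C v π H hdecay hcont hmild hdiv hsw hwg hI hnn hK hsing) hsing

/-- **The skeleton loses nothing**: the crux is EQUIVALENT to the conjunction of its two open stubs,
`TiltDominationLoc ↔ StubNoPlanarCollar ∧ StubApexTiltOfNeckLoc` (stub 1 `StubNeckLength` being proved). -/
theorem tiltDominationLoc_iff_stubs : TiltDominationLoc ↔ StubNoPlanarCollar ∧ StubApexTiltOfNeckLoc := by
  rw [tiltDominationLoc_iff_oneSignedRigidity, oneSignedRigidity_iff, stubNoPlanarCollar_iff_poloidalRigidity,
    stubApexTiltOfNeckLoc_iff_singularIsPoloidal]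

/-- **Typed edge to the shared crux 19708**: the window rigidity of poloidal Type-I profiles
(`FilamentPinchDoor.PoloidalWindowRigidity`, which needs neither suitability nor `𝐈 < ∞`) implies `PoloidalRigidity`,
hence stub 0 (`StubNoPlanarCollar`). -/
theorem poloidalRigidity_of_poloidalWindowRigidity
    (h : Summit.NavierStokesRegularity.NavierStokesRegularity.Theses.FilamentPinchDoor.PoloidalWindowRigidity) :
    PoloidalRigidity := by
  intro C v π H hdecay hcont hmild hdiv _ _ _ hpol
  refine (h C v hdecay hcont hmild hdiv).2 (EuclideanSpace.single (2 : Fin 3) (1 : ℝ)) ?_ ?_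
  · intro he
    have := congrArg (fun w : EuclideanSpace ℝ (Fin 3) => w 2) he
    simp at this
  · intro s hs
    exact ⟨univ, isOpen_univ, univ_nonempty, fun y _ => hpol s hs y⟩


/-! ### §3 The leaf's three routes meet: edges to `FilamentPinchDoor` (26430, 19708) and `HalfSpaceWindowDoor` (25311) -/

/-- `e₃ ≠ 0`. -/
theorem e3_ne_zero : (EuclideanSpace.single (2 : Fin 3) (1 : ℝ) : EuclideanSpace ℝ (Fin 3)) ≠ 0 := fun he => by
  simpa using congrArg (fun w : EuclideanSpace ℝ (Fin 3) => w 2) he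

/-- **Edge from FilamentPinchDoor's research crux** (item 26430, `FilamentPinchLiouville`: a one-signed, linearly
growing, backward-singular profile of the energy class is poloidal along its sign direction `e`): its instance
`e = e₃` is `SingularIsPoloidal`. -/
theorem singularIsPoloidal_of_filamentPinchLiouville
    (h : Summit.NavierStokesRegularity.NavierStokesRegularity.Theses.FilamentPinchDoor.FilamentPinchLiouville) :
    SingularIsPoloidal := by
  intro C v π H hdecay hcont hmild hdiv hsw hwg hI hnn hK hsing
  exact h C v π H hdecay hcont hmild hdiv hsw hwg hI _ e3_ne_zero hnn hK hsing

/-- **Edge from HalfSpaceWindowDoor's research crux** (item 25311, `CirculationCarryingRigidity`: a closed-hemisphere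
Type-I profile carrying SOME positive `⟪curl v, e⟫` is not backward-singular — no energy class needed): it implies
`SingularIsPoloidal`. -/
theorem singularIsPoloidal_of_circulationCarryingRigidity
    (h : Summit.NavierStokesRegularity.NavierStokesRegularity.Theses.HalfSpaceWindowDoor.CirculationCarryingRigidity) :
    SingularIsPoloidal := by
  intro C v π H hdecay hcont hmild hdiv _ _ _ hnn _ hsing s hs y
  by_contra hne
  have hpos : 0 < ⟪curl (v s) y, (EuclideanSpace.single (2 : Fin 3) (1 : ℝ))⟫_ℝ :=
    lt_of_le_of_ne (hnn s hs y) (Ne.symm hne)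
  exact h C v hdecay hcont hmild hdiv _ e3_ne_zero hnn ⟨s, hs, y, hpos⟩ hsing


/-- **Edge from HalfSpaceWindowDoor's re-typed research stub** (`HemisphereLiouvilleE3` of
`…HalfSpaceWindowDoorCirculationCarryingRigidityDefs`: EVERY one-signed profile of the Type-I class is poloidal — no
energy class, no singular apex needed): it implies `SingularIsPoloidal`. -/
theorem singularIsPoloidal_of_hemisphereLiouvilleE3
    (h : HalfSpaceWindowDoorCirculationCarryingRigidityDefs.HemisphereLiouvilleE3) : SingularIsPoloidal := by
  intro C v π H hdecay hcont hmild hdiv _ _ _ hnn _ _ s hs y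
  exact h C v hdecay hcont hmild hdiv hnn s hs y

/-- **The crux follows from FilamentPinchDoor's two research cruxes**: `PoloidalWindowRigidity` (19708) and
`FilamentPinchLiouville` (26430) together give `TiltDominationLoc` (26991). -/
theorem tiltDominationLoc_of_filamentPinchDoor
    (h₁ : Summit.NavierStokesRegularity.NavierStokesRegularity.Theses.FilamentPinchDoor.PoloidalWindowRigidity)
    (h₂ : Summit.NavierStokesRegularity.NavierStokesRegularity.Theses.FilamentPinchDoor.FilamentPinchLiouville) :
    TiltDominationLoc :=
  tiltDominationLoc_iff_oneSignedRigidity.2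
    (oneSignedRigidity_iff.2 ⟨poloidalRigidity_of_poloidalWindowRigidity h₁, singularIsPoloidal_of_filamentPinchLiouville h₂⟩)

/-- **Conversely, the crux implies FilamentPinchDoor's research crux 26430** in every direction `e ≠ 0`: the
one-signed rigidity is transported from `e₃` to `e` by the route's own `RotationToAxis` (`rotationToAxis_proof`), and a
backward-singular one-signed profile then does not exist. -/
theorem filamentPinchLiouville_of_tiltDominationLoc (hT : TiltDominationLoc) :
    Summit.NavierStokesRegularity.NavierStokesRegularity.Theses.FilamentPinchDoor.FilamentPinchLiouville := by
  have hR : OneSignedRigidity := tiltDominationLoc_iff_oneSignedRigidity.1 hT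
  intro C v π H hdecay hcont hmild hdiv hsw hwg hI e he hnn hK hsing
  exact absurd hsing
    (AxisTwistDoorRotationToAxis.rotationToAxis_proof hR e he C v π H hdecay hcont hmild hdiv hsw hwg hI hnn hK)

/-- **Stub 1 `stub_neckLength : StubNeckLength` of the skeleton of record, BY NAME** (the statement is the Defs
file's verbatim copy of the birth skeleton's Prop; the proof is ns-el-k1b's `…TiltDominationLoc.NeckLength.neckLength`,
p628658: slice Morrey bound of the energy class against the logarithmic cost of a long neck of circulation). -/
theorem stub_neckLength : StubNeckLength := TiltDominationLoc.NeckLength.neckLength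

end Summit.NavierStokesRegularity.NavierStokesRegularity.Theorems.AxisTwistDoorTiltDominationLocRigidity

end
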